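import Summits.ResolutionOfSingularities.ResolutionOfSingularities.Theorems.PurelyInseparableDim4ResConePrimeShadeTail
import Summits.ResolutionOfSingularities.ResolutionOfSingularities.Theorems.PurelyInseparableDim4ResConeHeavyPermanentSet
import HarnessLib
import HarnessLib.Audit.Tags

/-!
# Purely inseparable four-folds — TAIL(p, d, 2) WITH HEAVY HITS IS EMPTY, ∀ (p, d): the tracked Φ-frame follows every hit whose newborn
# weighs `≥ p − d`; the residue of every binary-cone tail below the top shade is «infinitely many LIGHT hits» (cell `res-dim4-pi`, K2(p)
# lane, slice C; HOLDER RULING g5-3 (7) 2026-08-29 09:39Z «p-7 = the Φ-side assembly: one tracked frame while the tracked letter and every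
# newborn it jumps to weigh ≥ p − d, + the statement of WHERE it fails»; rung-1 generic, no `7`)

[OURS · counted 0 · cell `res-dim4-pi` · K2(p) lane (holder res-dim4-p-12 g5); over the holder's tracked-frame socket
`ResCone.no_tail_of_tracked_frame` / `exists_weighted_hit` (`…ResConePrimeShadeTail`), res-dim4-p-5 g5's frame-free permanent-letter kill
`no_tail_of_permanent_heavy_letter` (`…ResConeHeavyPermanentSet`), and the E/K/L step triple ∀ (p, d, n) — res-dim4-p-9 g5's
`heavy_entryFrame`, this seat's `tail_heavy_keep_step`, res-dim4-p-2 g6's `tail_heavy_lose_step` / `tail_newborn_weight`; kernel hand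
res-dim4-p-7 g5.]  Nothing here proves K2(p) for any `p ≥ 7`, any TAIL(7, d, e), `NoIsolatedTrap p p` or resolution of singularities in
dimension ≥ 4 / characteristic `p` — NOT proved; a theorem about OUR frame's chains.  AI kernel work, weaker than expert review.

THE Φ-ADMISSIBLE LETTERS at shade `d` are the boundary letters of weight `w ≥ p − d` (`r_h + n = p` with `n = p − w ≤ d`): the E/K/L triple
frames such a letter, keeps the frame while the letter is kept (`βs` drops), and moves it onto the newborn when the letter is hit — PROVIDED
the newborn weighs `≥ p − d` again.  At the top shade `d = p − 1` every weighted letter qualifies and the holder's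
`no_primeShade_binaryCone_tail` kills the whole slice; below the top shade the tracker survives exactly as long as the hits are HEAVY:
* **`no_binaryCone_tail_of_heavy_hits (p)`** — along a witnessed isolated above-floor `Step0 p` chain with `x^{r₀} ∣ F₀`, constant shade
  `d < p` and `e_G ≡ 2` from `k₀`: if from some `k₁ ≥ k₀` EVERY step that hits (charts or translates) a weighted letter has a newborn of
  weight `≥ p − d` (`p ≤ (|r_k| + d − p) + d`), then `False`.  Proof: a first weighted hit (`exists_weighted_hit`) creates a heavy newborn
  `g`; either `g` is PERMANENT afterwards — dead by `no_tail_of_permanent_heavy_letter` (ledger + FT, no frame) — or it is hit at a first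
  later time `k₃` with its weight intact: E (`heavy_entryFrame`, transversal because hit) + L (`tail_heavy_lose_step`) frame the newborn
  `j k₃` with `0 < αs`, and the holder's `no_tail_of_tracked_frame` runs with run datum «weight `≥ p − d` + frame + `0 < αs`», `Φ := βs`,
  (L) by `tail_heavy_lose_step` (heavy newborn by hypothesis), (K) by `tail_heavy_keep_step`;
* **`binaryCone_tail_frequently_light_hit (p)`** — WHERE IT FAILS, as the residue of record: every such tail has, beyond every index, a
  step hitting a weighted letter whose newborn weighs `< p − d` (`|r_k| + 2d < 2p`).  At `d = p − 2`: a weighted hit with `|r_k| = 3`,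
  i.e. «`r_a + r_a′ + W = 3`» in the holder's two-letter-game-plus-frozen-monomial picture — infinitely often.
At `d = p − 1` the hypothesis of the first theorem is automatic (`tail_newborn_weight`), recovering `no_primeShade_binaryCone_tail`.
[cite: CossartJannsenSaito2020, Thm. 3.14, Lemma 13.4 (3), Thm. 13.7] [cite: CossartPiltant2008, (16), Lemma 4.5 (2)]
[cite: HauserPerlega2019PRIMS, §2 (transform D′ of D)]
bears_on: LADDER-RESOLUTION:D157-DOOR2 (res-dim4-pi · K2(p) rung 1 · TAIL(p, d, 2) with heavy hits).  Supports
stmt-ResolutionOfSingularities-16155 (helper).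
-/

set_option linter.dupNamespace false -- mandated namespace of this single-conjunct summit

noncomputable section

namespace Summit.ResolutionOfSingularities.ResolutionOfSingularities.Theorems.PIDim4

namespace ResCone

open MvPolynomial Finset IsLocalRing
open Literature.AlgebraicGeometry.Resolution
open Literature.AlgebraicGeometry.Resolution.CentreBlowup
open Literature.AlgebraicGeometry.Resolution.Hauser2010
open Literature.AlgebraicGeometry.Resolution.HauserPerlega2019
open Literature.AlgebraicGeometry.Resolution.WeightedOrder
open PointBlowup (direction)

variable {K : Type} [Field K] (p : ℕ) [hp : Fact p.Prime] [CharP K p] [DecidableEq K]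

/-- **TAIL(p, d, 2) WITH HEAVY HITS IS EMPTY, ∀ (p, d).**  Along a witnessed isolated above-floor `Step0 p` chain with `x^{r₀} ∣ F₀`,
constant shade `d < p` and `e_G ≡ 2` from `k₀`: if from `k₁ ≥ k₀` every step hitting a weighted boundary letter has a newborn of weight
`≥ p − d`, the chain cannot exist.  See the module docstring for the composition. [OURS]
[cite: CossartJannsenSaito2020, Thm. 3.14, Lemma 13.4 (3), Thm. 13.7] [cite: CossartPiltant2008, (16)] -/
theorem no_binaryCone_tail_of_heavy_hits {c : ℕ → State K} {j : ℕ → Fin 4} {b : ℕ → Fin 4 → K}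
    (hc : ∀ k, IsIsolated p (c k).F ∧ Step0 p (c k) (c (k + 1))) (hw : FreeTail.IsWitnessedChain p c j b)
    (hr0 : ∀ e ∈ (c 0).F.support, (c 0).r ≤ e) (hfloor : ∀ k, ordZero (c k).F ≠ p) {k₀ d : ℕ} (hdp : d < p)
    (hshade : ∀ k, k₀ ≤ k → (c k).shade = (d : ℕ∞))
    (he : ∀ k, k₀ ≤ k → Module.finrank K (resVertex (c k)) = 2) {k₁ : ℕ} (hk₁ : k₀ ≤ k₁)
    (hheavy : ∀ k, k₁ ≤ k → (∃ W : Fin 4, 1 ≤ (c k).r W ∧ (j k = W ∨ b k W ≠ 0)) →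
      p ≤ ((c k).r.degree + d - p) + d) : False := by
  classical
  obtain ⟨-, hlaw, hbj, hband, hpair⟩ := tail_weights_laws hc hw hr0 hfloor hshade
  -- every weight is `≤ p − 2` (isolation pair law with any other letter)
  have hle : ∀ k (i : Fin 4), (c k).r i ≤ p - 2 := by
    intro k i
    obtain ⟨i', hi'⟩ := exists_ne i
    have := hpair k i i' (Ne.symm hi')
    omega
  -- a kept letter keeps its weight
  have hkept : ∀ k, k₀ ≤ k → ∀ (h : Fin 4), j k ≠ h → b k h = 0 → (c (k + 1)).r h = (c k).r h := by
    intro k hk h hjh hbh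
    rw [hlaw k hk, Finsupp.coe_update, Function.update_of_ne (Ne.symm hjh),
      Finsupp.filter_apply_pos (fun i => b k i = 0) ((c k).r) hbh]
  -- the tracked-frame kill from ANY run frame on a heavy letter at a time `m ≥ k₁`
  have htrack : ∀ m, k₁ ≤ m → ∀ (g : Fin 4) (L : Fin (2 + 2) → Fin 4 → K) (M : Fin 4 → Fin (2 + 2) → K),
      p ≤ (c m).r g + d →
      (∀ t u, ∑ s, M t s * L s u = if t = u then 1 else 0) → L (u1 2) = Pi.single g 1 →
      (∀ s, s ≠ u1 2 → s ≠ u2 2 → ∀ w ∈ resVertex (c m), ∑ t, L s t * w t = 0) →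
      (pts (fun s => algebraMap (MvPolynomial (Fin 4) K) (OriginLocalization K 4) (∑ t, C (L s t) * X t))
        (Ideal.span {algebraMap (MvPolynomial (Fin 4) K) (OriginLocalization K 4)
            ((c m).F.divMonomial (c m).r)}) d).Nonempty →
      Nat.factorial d < deltaS (fun s => algebraMap (MvPolynomial (Fin 4) K) (OriginLocalization K 4) (∑ t, C (L s t) * X t))
        (Ideal.span {algebraMap (MvPolynomial (Fin 4) K) (OriginLocalization K 4)
            ((c m).F.divMonomial (c m).r)}) d →
      0 < alphaS (fun s => algebraMap (MvPolynomial (Fin 4) K) (OriginLocalization K 4) (∑ t, C (L s t) * X t))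
        (Ideal.span {algebraMap (MvPolynomial (Fin 4) K) (OriginLocalization K 4)
            ((c m).F.divMonomial (c m).r)}) d → False := by
    intro m hm g L₁ M₁ hwg hM₁ hL₁u1 hy₁ hne₁ hδ₁ hpos₁
    refine no_tail_of_tracked_frame p hc hw (k₁ := m)
      (Fr := (Fin (2 + 2) → Fin 4 → K) × (Fin 4 → Fin (2 + 2) → K))
      (fun k i f => p ≤ (c k).r i + d ∧
        (∀ t u, ∑ s, f.2 t s * f.1 s u = if t = u then 1 else 0) ∧ f.1 (u1 2) = Pi.single i 1 ∧
        (∀ s, s ≠ u1 2 → s ≠ u2 2 → ∀ w ∈ resVertex (c k), ∑ t, f.1 s t * w t = 0) ∧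
        (pts (fun s => algebraMap (MvPolynomial (Fin 4) K) (OriginLocalization K 4) (∑ t, C (f.1 s t) * X t))
          (Ideal.span {algebraMap (MvPolynomial (Fin 4) K) (OriginLocalization K 4)
              ((c k).F.divMonomial (c k).r)}) d).Nonempty ∧
        Nat.factorial d < deltaS (fun s => algebraMap (MvPolynomial (Fin 4) K) (OriginLocalization K 4) (∑ t, C (f.1 s t) * X t))
          (Ideal.span {algebraMap (MvPolynomial (Fin 4) K) (OriginLocalization K 4)
              ((c k).F.divMonomial (c k).r)}) d ∧
        0 < alphaS (fun s => algebraMap (MvPolynomial (Fin 4) K) (OriginLocalization K 4) (∑ t, C (f.1 s t) * X t))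
          (Ideal.span {algebraMap (MvPolynomial (Fin 4) K) (OriginLocalization K 4)
              ((c k).F.divMonomial (c k).r)}) d)
      (fun k f => betaS (fun s => algebraMap (MvPolynomial (Fin 4) K) (OriginLocalization K 4) (∑ t, C (f.1 s t) * X t))
          (Ideal.span {algebraMap (MvPolynomial (Fin 4) K) (OriginLocalization K 4)
              ((c k).F.divMonomial (c k).r)}) d)
      ?_ ?_ (h₀ := g) (f₀ := ⟨L₁, M₁⟩) ⟨hwg, hM₁, hL₁u1, hy₁, hne₁, hδ₁, hpos₁⟩
    · -- (L): a hit of the tracked (heavy, hence weighted) letter has a HEAVY newborn by hypothesis; the frame follows it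
      rintro k hk h ⟨L, M⟩ ⟨hwh, hM, hLu1, hy, hne, hδ, -⟩ hhit'
      have hk0 : k₀ ≤ k := by omega
      obtain ⟨hpo, ho2⟩ := hband k hk0
      have hnb : p ≤ ((c k).r.degree + d - p) + d := hheavy k (by omega) ⟨h, by omega, hhit'⟩
      obtain ⟨L', M', ⟨hM', hL'u1, hy', hne', hδ', -⟩, hpos', hle'⟩ := tail_heavy_lose_step (p := p) (d := d)
        (n := p - ((c k).r.degree + d - p)) hdp (by omega) hc hw hr0 hfloor hshade he hk0 (by omega)
        (heavyLine_direction_ne_zero (hbj k) hhit') hM hLu1 hy hne hδ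
      obtain ⟨hnew, -, -, -⟩ := tail_newborn_weight hc hw hr0 hfloor hshade hk0
      exact ⟨⟨L', M'⟩, ⟨by rw [hnew]; omega, hM', hL'u1, hy', hne', hδ', hpos'⟩, hle'⟩
    · -- (K): the frame stays on the kept heavy letter, `βs` drops (`n := p − r_k h ∈ [1, d]`)
      rintro k hk h ⟨L, M⟩ ⟨hwh, hM, hLu1, hy, hne, hδ, hα0⟩ hjh hbh
      have hk0 : k₀ ≤ k := by omega
      have hrle := hle k h
      obtain ⟨L', M', ⟨hM', hL'u1, hy', hne', hδ', -⟩, hpos', hlt'⟩ := tail_heavy_keep_step (p := p) (d := d)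
        (n := p - (c k).r h) hdp (by omega) (by omega) hc hw hr0 hfloor hshade he hk0 (h := h) (by omega) hjh hbh
        hM hLu1 hy hne hδ hα0
      exact ⟨⟨L', M'⟩, ⟨by rw [hkept k hk0 h hjh hbh]; exact hwh, hM', hL'u1, hy', hne', hδ', hpos'⟩, hlt'⟩
  -- a first weighted hit at `k₂ ≥ k₁`; its newborn `g := j k₂` is heavy
  obtain ⟨k₂, hk₂, W, hW1, hhit⟩ := exists_weighted_hit p hc hw hr0 hfloor hshade (k₂ := k₁) hk₁
  have hk₂0 : k₀ ≤ k₂ := by omega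
  have hnb₂ : p ≤ ((c k₂).r.degree + d - p) + d := hheavy k₂ hk₂ ⟨W, hW1, hhit⟩
  obtain ⟨hnew₂, -, -, -⟩ := tail_newborn_weight hc hw hr0 hfloor hshade hk₂0
  have hg : p ≤ d + (c (k₂ + 1)).r (j k₂) := by rw [hnew₂]; omega
  -- either `g` is permanent from `k₂ + 1` (dead by the ledger) or it is hit again at a first later time `k₃`
  by_cases hperm : ∀ k, k₂ + 1 ≤ k → j k ≠ j k₂ ∧ b k (j k₂) = 0
  · exact no_tail_of_permanent_heavy_letter p hc hw hr0 hfloor hshade (M := k₂ + 1) (by omega) hperm hg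
  · push Not at hperm
    -- the FIRST later hit of `g`
    have hex : ∃ t, ¬ (j (k₂ + 1 + t) ≠ j k₂ ∧ b (k₂ + 1 + t) (j k₂) = 0) := by
      obtain ⟨k, hk, hk'⟩ := hperm
      exact ⟨k - (k₂ + 1), by rw [show k₂ + 1 + (k - (k₂ + 1)) = k by omega]; exact fun h => hk' h.1 h.2⟩
    let t₀ := Nat.find hex
    have ht₀ : ¬ (j (k₂ + 1 + t₀) ≠ j k₂ ∧ b (k₂ + 1 + t₀) (j k₂) = 0) := Nat.find_spec hex
    have hbefore : ∀ t, t < t₀ → j (k₂ + 1 + t) ≠ j k₂ ∧ b (k₂ + 1 + t) (j k₂) = 0 := fun t ht => by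
      have := Nat.find_min hex ht
      push Not at this
      exact this
    set k₃ := k₂ + 1 + t₀ with hk₃def
    have hk₃0 : k₀ ≤ k₃ := by omega
    have hhit₃ : j k₃ = j k₂ ∨ b k₃ (j k₂) ≠ 0 := by
      by_contra hno; push Not at hno; exact ht₀ hno
    -- the weight of `g` is intact at `k₃`
    have hwg : ∀ t, t ≤ t₀ → (c (k₂ + 1 + t)).r (j k₂) = (c (k₂ + 1)).r (j k₂) := by
      intro t ht
      induction t with
      | zero => rfl
      | succ t ih =>
        obtain ⟨hj, hb⟩ := hbefore t (by omega)
        rw [show k₂ + 1 + (t + 1) = k₂ + 1 + t + 1 by ring, hkept _ (by omega) _ hj hb, ih (by omega)]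
    have hwg₃ : p ≤ (c k₃).r (j k₂) + d := by rw [hk₃def, hwg t₀ le_rfl]; omega
    -- E at `k₃` on `g` (`n := p − r g ≤ d`), transversal because hit; then L across step `k₃` onto the heavy newborn
    obtain ⟨hpo₃, ho2₃⟩ := hband k₃ hk₃0
    have hle₃ := hle k₃ (j k₂)
    obtain ⟨L₀, M₀, hM₀, hL₀u1, hy₀, hne₀, hδ₀, -⟩ := heavy_entryFrame (p := p) (d := d) (n := p - (c k₃).r (j k₂)) hdp
      (by omega) hc hw hr0 hfloor hshade he hk₃0 (W := j k₂) (by omega) (heavyLine_direction_ne_zero (hbj k₃) hhit₃)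
    have hnb₃ : p ≤ ((c k₃).r.degree + d - p) + d := hheavy k₃ (by omega) ⟨j k₂, by omega, hhit₃⟩
    obtain ⟨L₁, M₁, ⟨hM₁, hL₁u1, hy₁, hne₁, hδ₁, -⟩, hpos₁, -⟩ := tail_heavy_lose_step (p := p) (d := d)
      (n := p - ((c k₃).r.degree + d - p)) hdp (by omega) hc hw hr0 hfloor hshade he hk₃0 (by omega)
      (heavyLine_direction_ne_zero (hbj k₃) hhit₃) hM₀ hL₀u1 hy₀ hne₀ hδ₀
    obtain ⟨hnew₃, -, -, -⟩ := tail_newborn_weight hc hw hr0 hfloor hshade hk₃0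
    exact htrack (k₃ + 1) (by omega) (j k₃) L₁ M₁ (by rw [hnew₃]; omega) hM₁ hL₁u1 hy₁ hne₁ hδ₁ hpos₁

/-- **WHERE THE TRACKER FAILS — the residue of record for every binary-cone tail below the top shade: LIGHT HITS RECUR.**  Along a
witnessed isolated above-floor `Step0 p` chain with `x^{r₀} ∣ F₀`, constant shade `d < p` and `e_G ≡ 2` from `k₀`, beyond every index
there is a step that hits a weighted boundary letter and whose newborn weighs `< p − d` (`|r_k| + 2d < 2p`).  At `d = p − 2`: a weighted
hit at a state with `|r_k| = 3` («`r_a + r_a′ + W = 3`»), infinitely often. [OURS] [cite: CossartJannsenSaito2020, Thm. 3.14, Thm. 13.7] -/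
theorem binaryCone_tail_frequently_light_hit {c : ℕ → State K} {j : ℕ → Fin 4} {b : ℕ → Fin 4 → K}
    (hc : ∀ k, IsIsolated p (c k).F ∧ Step0 p (c k) (c (k + 1))) (hw : FreeTail.IsWitnessedChain p c j b)
    (hr0 : ∀ e ∈ (c 0).F.support, (c 0).r ≤ e) (hfloor : ∀ k, ordZero (c k).F ≠ p) {k₀ d : ℕ} (hdp : d < p)
    (hshade : ∀ k, k₀ ≤ k → (c k).shade = (d : ℕ∞))
    (he : ∀ k, k₀ ≤ k → Module.finrank K (resVertex (c k)) = 2) (k₁ : ℕ) (hk₁ : k₀ ≤ k₁) :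
    ∃ k, k₁ ≤ k ∧ (∃ W : Fin 4, 1 ≤ (c k).r W ∧ (j k = W ∨ b k W ≠ 0)) ∧ (c k).r.degree + 2 * d < 2 * p := by
  by_contra hno
  push Not at hno
  exact no_binaryCone_tail_of_heavy_hits p hc hw hr0 hfloor hdp hshade he hk₁ fun k hk hhit => by
    have := hno k hk hhit; omega

end ResCone

end Summit.ResolutionOfSingularities.ResolutionOfSingularities.Theorems.PIDim4

end
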